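import Summits.QuantumFields.BalabanUV.Beta.GAN24.CubicSectorLevelDown
import Summits.QuantumFields.BalabanUV.Beta.GAN24.CombFreeGaugeLegCharges

/-!
# `BalabanUV.Beta.GAN24.LambdaMemberPairing` — binder row G-an2-4 ∕ (CONV-C), the (S) row ∕ (W-γ) one level up, the (ζ-Λ) step, PART A1:
# **THE LAGRANGE MEMBER OF `SrecAt j` (no multiplier rows, local at every level) AND THE TWO-LEG PAIRING OF an1's CONSTRAINT-HESSIAN TABLE (finite support ⇒ the iterated
# table `T_j(μ,Y)`, uniformly bounded)**
# (G-an2-4 CRUX TEAM (2), seat `b2b-balaban-gan24-formalise-leaf-06` = the (γ) hand, gen 50, INTENT 1, PART A1)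

NOT IN PRINT; OUR BOOKKEEPING ([folklore] BY NAME over node 7a's `InterLevelTransport.locStencil_SLam`, `BalabanStepJetsSucc.abs_lamCoeffK_le`, an1's
`AveragingHessianKernelsRooted.biLoc_hessFFAt`, leaf-06 FILE A's finite-support bookkeeping `CombFreeGaugeLegCharges.hasSum_prod_of_support` and leaf-02 g61's PART 3
`CubicPushGaugeLegUnfoldingFF.abs_fieldResponse_le'`; 0 `def`, 0 cited fact, 0 `def … : Prop`, 0 sorry).
HONEST FRAMING (cell contract, verbatim): «discharging `BetaPertH` makes Bałaban's UV stability UNCONDITIONAL — a real constructive-QFT result; it is NOT the continuum limit and NOT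
the Clay problem.»  HONEST DEPENDENCY (verbatim): «continuum YM on T⁴ ⇐ BetaPertH ∧ nine spine estimates (0/9 proved); BetaPertH ⇐ (D1) ∧ (D4) ∧ CAP+tail; G-an2-4 gates asym,
D1 and NE2/3/4.»

WHY.  The Λ member of `SrecAt j` is `(cΛ·wΛ_j) • SΛ_j`, `SΛ_j κ′ u′ = SLam Lc (lamCoeffK (KInvStep Lc j) (E2 j) Lc) (hessFFAt ρ Lc) κ′ u′ = −Σ_μ Σ'_Y lamCoeffK_j μ Y κ′ u′ • hessFFAt ρ Lc μ Y`.
To push it through TODAY's `CubicSectorLevelDown.slotSum_gaugeLeg_e3OfK_ff` one needs (§1) that it is a LOCAL stencil family WITHOUT multiplier rows and that its conversion coefficients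
decay from the coarse bond, and (§2) that an1's table `hessFFAt ρ Lc μ Y`, supported on `nearBox Lc Y × nearBox Lc Y`, pairs against two bounded weights `(A, dzΨ)` as the ITERATED
table `Σ'_y Σ_κ″ A κ″ y·(Σ'_w Σ_a hessFFAt ρ Lc μ Y y w (inl κ″)(inl a)·dzΨ a w)` of (β) ∕ (δ2b) §3 ∕ (ε-Λ) §3, with a pointwise exponential majorant and a uniform bound — the inputs of
PART A2 `LambdaSectorSlotSum` (the inner pairing of the member and the slot sum).
* §1 `SLam_hessFFAt_inr_inl_eq_zero`, `locStencil_SLam_lamCoeffK` (every `j`), `exists_abs_lamCoeffK_le`.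
* §2 `tsum_prod_hessFFAt_pairing_eq_iterated` (hypothesis-free), `abs_hessFFAt_pairing_summand_le`, **`abs_lambdaTable_le`** (`|T_j(μ,Y)| ≤ BT` uniformly, bounded `n`, `φ`).
Asserts NO value of any resolvent column; NOTHING of (C2′) beyond (δ2b) ∕ `hX` ∕ (W-γ) at levels ≥ 1 ∕ (INV) ∕ (S) discharged; NEVER «G-an2-4 closed» as (CONV-C); NOT D1, NOT `BetaPertH`,
NOT continuum, NOT Clay.  2026-08-23; no existing file touched.
-/

noncomputable section

open Finset
open scoped BigOperators
open Literature.MathematicalPhysics.QuantumFieldTheory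
open Literature.MathematicalPhysics.QuantumFieldTheory.Balaban1983to89
open Literature.MathematicalPhysics.QuantumFieldTheory.Balaban1983to89.Beta
open B12Sec2to5 (l1 l1_nonneg)
open ExpKernelCalculus (Site MKer BiLoc Decays Zl Zl_nonneg summable_exp_shift summable_exp_shift' tsum_exp_shift' l1_sub_symm VertexFamily)
open OneStepResolventKernel (Fib LocStencil decays_mono)
open AffineAveraging (Form0 Form1 box toSite unitVec dz)
open AveragingContours (blk)
open AveragingHessianKernels (ell)
open AveragingHessianKernelsRooted (hessFFAt hessFFAt_inr biLoc_hessFFAt)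
open InterLevelTransport (SLam cwsum cwsum_apply locStencil_SLam)
open OneStepKernelFamily (KInvStep colH decays_KInvStep)
open BalabanStepJetsSucc (E2 lamCoeffK abs_lamCoeffK_le decays_E2)
open Summit.QuantumFields.BalabanUV.Beta.AxialDressingRooted (coDressKBmAt decays_coDressKBmAt one_le_of_neZero)
open Summit.QuantumFields.BalabanUV.Beta.BorderedHessian (stepScale)
open Summit.QuantumFields.BalabanUV.Beta.SpineRooted (e3OfK)
open Summit.QuantumFields.BalabanUV.Beta.LinearGaugeVH (nearBox mem_nearBox summable_of_finsupp)
open Summit.QuantumFields.BalabanUV.Beta.GAN24.ResolventLegCharges (tsum_exp_coarse_le')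
open Summit.QuantumFields.BalabanUV.Beta.GAN24.CoarseGaugeSourceResponse (summable_bdd_mul)
open Summit.QuantumFields.BalabanUV.Beta.GAN24.CombFreeGaugeLegCharges (hasSum_prod_of_support hessFFAt_inl_inl_eq_zero_of_not_mem₂)
open Summit.QuantumFields.BalabanUV.Beta.GAN24.CubicPushGaugeLegUnfoldingFF (abs_fieldResponse_le')
open Summit.QuantumFields.BalabanUV.Beta.GAN24.CubicSectorLevelDown (summable_fieldResponse slotSum_gaugeLeg_e3OfK_ff)

namespace Summit.QuantumFields.BalabanUV.Beta.GAN24.LambdaMemberPairing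

variable {d : ℕ}

/-! ## §1 The Lagrange member: no multiplier rows, locality, decay of the conversion coefficients -/

/-- [folklore] **THE LAGRANGE MEMBER HAS NO MULTIPLIER ROWS**: an1's constraint-Hessian table lives in the field–field slot, so every superposition `SLam N c (hessFFAt ρ L)` vanishes on
`(inr, inl)`. -/
theorem SLam_hessFFAt_inr_inl_eq_zero {N : ℕ} [NeZero N] (c : Fin (d + 1) → Site (d + 1) → Fin (d + 1) → Site (d + 1) → ℝ) (ρ : Site (d + 1)) (L : ℕ)
    (κ' : Fin (d + 1)) (u' y w : Site (d + 1)) (m a : Fin (d + 1)) :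
    SLam N c (fun μ y => hessFFAt ρ L μ y) κ' u' y w (Sum.inr m) (Sum.inl a) = 0 := by
  simp only [SLam, cwsum_apply, hessFFAt_inr, mul_zero, tsum_zero, Finset.sum_const_zero, neg_zero]

section Step

variable {Lc : ℕ} [NeZero Lc] {r : Fin (d + 1) → ℕ}

/-- [folklore] **THE LAGRANGE MEMBER IS A LOCAL STENCIL FAMILY** (in-block root, every `j`): `locStencil_SLam` with the decay of `lamCoeffK (KInvStep Lc j) (E2 j)`
(`abs_lamCoeffK_le`) and the bi-localisation of `hessFFAt` (leaf-10's `WardLocusRecursive.locStencil_SrecAt`, the Λ summand, at every `j`). -/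
theorem locStencil_SLam_lamCoeffK (hr : r ∈ box (d + 1) Lc) (j : ℕ) :
    ∃ Cs δ : ℝ, 0 < δ ∧ LocStencil (SLam Lc (lamCoeffK (KInvStep (d := d) Lc j) (E2 d Lc j) Lc) (fun μ y => hessFFAt (toSite r) Lc μ y)) Cs δ := by
  have hLc : 1 ≤ Lc := one_le_of_neZero Lc
  obtain ⟨δA, CA, hδA, hCA, hA⟩ := decays_KInvStep (Lc := Lc) (d := d) j
  obtain ⟨δE, CE, hδE, hCE, hE⟩ := decays_E2 (d := d) (Lc := Lc) j
  set n : ℝ := min δA δE with hn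
  have hn0 : 0 < n := lt_min hδA hδE
  have hA' : Decays (KInvStep (d := d) Lc j) CA n := decays_mono hA hCA le_rfl (min_le_left _ _)
  have hE' : Decays (E2 d Lc j) CE n := decays_mono hE hCE le_rfl (min_le_right _ _)
  have hc := abs_lamCoeffK_le hA' hE' hn0 Lc
  have hn2 : (0 : ℝ) ≤ n / 2 := by positivity
  have hQ : VertexFamily (fun μ y => hessFFAt (toSite r) Lc μ y) Lc
      (2 * (ell (d + 1) Lc : ℝ) ^ 2 * Real.exp (4 * ((d : ℝ) + 1) * Lc * (n / 2))) (n / 2) :=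
    fun μ y => biLoc_hessFFAt hLc μ y hr hn2
  have h3 := locStencil_SLam (N := Lc) hc hQ (by positivity)
    (mul_nonneg (mul_nonneg (Nat.cast_nonneg _) (mul_nonneg hCA hCE)) (Zl_nonneg (by linarith)))
  exact ⟨_, _, by positivity, h3⟩

/-- [folklore] **THE CONVERSION COEFFICIENTS DECAY FROM THE COARSE BOND** (every `j`; one displayed constant and rate): `|lamCoeffK_j μ Y κ′ u′| ≤ Cl·e^{−δl·|Lc•Y − u′|₁}`. -/
theorem exists_abs_lamCoeffK_le (j : ℕ) :
    ∃ Cl δl : ℝ, 0 < δl ∧ 0 ≤ Cl ∧ ∀ (μ : Fin (d + 1)) (Y : Site (d + 1)) (κ' : Fin (d + 1)) (u' : Site (d + 1)),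
      |lamCoeffK (KInvStep (d := d) Lc j) (E2 d Lc j) Lc μ Y κ' u'| ≤ Cl * Real.exp (-δl * l1 ((Lc : ℤ) • Y - u')) := by
  obtain ⟨δA, CA, hδA, hCA, hA⟩ := decays_KInvStep (Lc := Lc) (d := d) j
  obtain ⟨δE, CE, hδE, hCE, hE⟩ := decays_E2 (d := d) (Lc := Lc) j
  set n : ℝ := min δA δE with hn
  have hn0 : 0 < n := lt_min hδA hδE
  have hA' : Decays (KInvStep (d := d) Lc j) CA n := decays_mono hA hCA le_rfl (min_le_left _ _)
  have hE' : Decays (E2 d Lc j) CE n := decays_mono hE hCE le_rfl (min_le_right _ _)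
  refine ⟨(Fintype.card (Fib d) : ℝ) * (CA * CE) * Zl (d + 1) (n - n / 2), n / 2, by positivity,
    mul_nonneg (mul_nonneg (Nat.cast_nonneg _) (mul_nonneg hCA hCE)) (Zl_nonneg (by linarith)), fun μ Y κ' u' => ?_⟩
  exact abs_lamCoeffK_le hA' hE' hn0 Lc μ Y κ' u'

/-! ## §2 The two-leg pairing of the constraint-Hessian table -/

omit [NeZero Lc] in
/-- [folklore] **THE TWO-LEG PAIRING OF `hessFFAt ρ Lc μ Y` IS THE ITERATED TABLE** (in-block root; NO hypothesis on the weights — the table is supported on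
`nearBox Lc Y × nearBox Lc Y`): `Σ'_{(y,w)} Σ_κ″ Σ_a A κ″ y·dzΨ a w·hessFFAt ρ Lc μ Y y w (inl κ″)(inl a) = Σ'_y Σ_κ″ A κ″ y·(Σ'_w Σ_a hessFFAt ρ Lc μ Y y w (inl κ″)(inl a)·dzΨ a w)`. -/
theorem tsum_prod_hessFFAt_pairing_eq_iterated (hr : r ∈ box (d + 1) Lc) (μ : Fin (d + 1)) (Y : Site (d + 1)) (A : Form1 (d + 1) ℝ) (Ψ : Site (d + 1) → ℝ) :
    ∑' yw : Site (d + 1) × Site (d + 1), ∑ κ'' : Fin (d + 1), ∑ a : Fin (d + 1),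
        A κ'' yw.1 * dz Ψ a yw.2 * hessFFAt (toSite r) Lc μ Y yw.1 yw.2 (Sum.inl κ'') (Sum.inl a)
      = ∑' y : Site (d + 1), ∑ κ'' : Fin (d + 1), A κ'' y *
        (∑' w : Site (d + 1), ∑ a : Fin (d + 1), hessFFAt (toSite r) Lc μ Y y w (Sum.inl κ'') (Sum.inl a) * dz Ψ a w) := by
  classical
  have h := hasSum_prod_of_support (F := fun y w => ∑ κ'' : Fin (d + 1), ∑ a : Fin (d + 1),
      A κ'' y * dz Ψ a w * hessFFAt (toSite r) Lc μ Y y w (Sum.inl κ'') (Sum.inl a)) (nearBox Lc Y) (nearBox Lc Y)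
    (fun y w hyw => Finset.sum_eq_zero fun κ'' _ => Finset.sum_eq_zero fun a _ => by
      rw [hessFFAt_inl_inl_eq_zero_of_not_mem₂ hr μ Y y w κ'' a hyw, mul_zero])
  rw [h.tsum_eq]
  refine tsum_congr fun y => ?_
  have hs : ∀ κ'', Summable fun w : Site (d + 1) => ∑ a : Fin (d + 1), A κ'' y * dz Ψ a w * hessFFAt (toSite r) Lc μ Y y w (Sum.inl κ'') (Sum.inl a) :=
    fun κ'' => summable_of_finsupp (nearBox Lc Y) fun w hw =>
      Finset.sum_eq_zero fun a _ => by rw [hessFFAt_inl_inl_eq_zero_of_not_mem₂ hr μ Y y w κ'' a (Or.inr hw), mul_zero]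
  rw [Summable.tsum_finsetSum (fun κ'' _ => hs κ'')]
  refine Finset.sum_congr rfl fun κ'' _ => ?_
  rw [← tsum_mul_left]
  refine tsum_congr fun w => ?_
  rw [Finset.mul_sum]
  exact Finset.sum_congr rfl fun a _ => by ring

/-- [folklore] **POINTWISE MAJORANT OF THE PAIRING SUMMAND** (in-block root; `|A| ≤ BA`, `|dzΨ| ≤ BΨ`): with node 7a's constant `Cq = 2ℓ²·e^{4(d+1)Lc}` (bi-localisation of `hessFFAt` at
rate `1`), `|Σ_κ″ Σ_a A κ″ y·dzΨ a w·hessFFAt ρ Lc μ Y y w (inl κ″)(inl a)| ≤ (d+1)²·BA·BΨ·Cq·e^{−|y − Lc•Y|₁}·e^{−|w − Lc•Y|₁}`. -/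
theorem abs_hessFFAt_pairing_summand_le (hr : r ∈ box (d + 1) Lc) (μ : Fin (d + 1)) (Y : Site (d + 1)) {A : Form1 (d + 1) ℝ} {BA : ℝ} (hA : ∀ κ y, |A κ y| ≤ BA)
    {Ψ : Site (d + 1) → ℝ} {BΨ : ℝ} (hΨ : ∀ a w, |dz Ψ a w| ≤ BΨ) (y w : Site (d + 1)) :
    |∑ κ'' : Fin (d + 1), ∑ a : Fin (d + 1), A κ'' y * dz Ψ a w * hessFFAt (toSite r) Lc μ Y y w (Sum.inl κ'') (Sum.inl a)|
      ≤ ((d + 1 : ℕ) : ℝ) * (((d + 1 : ℕ) : ℝ) * (BA * BΨ * (2 * (ell (d + 1) Lc : ℝ) ^ 2 * Real.exp (4 * ((d : ℝ) + 1) * Lc * 1))))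
        * (Real.exp (-1 * l1 (y - (Lc : ℤ) • Y)) * Real.exp (-1 * l1 (w - (Lc : ℤ) • Y))) := by
  have hLc : 1 ≤ Lc := one_le_of_neZero Lc
  have hBA : 0 ≤ BA := (abs_nonneg _).trans (hA 0 0)
  have hBΨ : 0 ≤ BΨ := (abs_nonneg _).trans (hΨ 0 0)
  have hq := biLoc_hessFFAt (d := d) hLc μ Y hr (δ := 1) zero_le_one
  set Cq : ℝ := 2 * (ell (d + 1) Lc : ℝ) ^ 2 * Real.exp (4 * ((d : ℝ) + 1) * Lc * 1) with hCq
  have hterm : ∀ κ'' a, |A κ'' y * dz Ψ a w * hessFFAt (toSite r) Lc μ Y y w (Sum.inl κ'') (Sum.inl a)|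
      ≤ BA * BΨ * Cq * (Real.exp (-1 * l1 (y - (Lc : ℤ) • Y)) * Real.exp (-1 * l1 (w - (Lc : ℤ) • Y))) := by
    intro κ'' a
    rw [abs_mul, abs_mul]
    have e3 : |hessFFAt (toSite r) Lc μ Y y w (Sum.inl κ'') (Sum.inl a)| ≤ Cq * (Real.exp (-1 * l1 (y - (Lc : ℤ) • Y)) * Real.exp (-1 * l1 (w - (Lc : ℤ) • Y))) := by
      have := hq y w (Sum.inl κ'') (Sum.inl a)
      rwa [mul_add, Real.exp_add] at this
    calc |A κ'' y| * |dz Ψ a w| * |hessFFAt (toSite r) Lc μ Y y w (Sum.inl κ'') (Sum.inl a)|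
        ≤ BA * BΨ * (Cq * (Real.exp (-1 * l1 (y - (Lc : ℤ) • Y)) * Real.exp (-1 * l1 (w - (Lc : ℤ) • Y)))) :=
          mul_le_mul (mul_le_mul (hA κ'' y) (hΨ a w) (abs_nonneg _) hBA) e3 (abs_nonneg _) (by positivity)
      _ = _ := by ring
  calc |∑ κ'' : Fin (d + 1), ∑ a : Fin (d + 1), A κ'' y * dz Ψ a w * hessFFAt (toSite r) Lc μ Y y w (Sum.inl κ'') (Sum.inl a)|
      ≤ ∑ κ'' : Fin (d + 1), |∑ a : Fin (d + 1), A κ'' y * dz Ψ a w * hessFFAt (toSite r) Lc μ Y y w (Sum.inl κ'') (Sum.inl a)| := Finset.abs_sum_le_sum_abs _ _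
    _ ≤ ∑ κ'' : Fin (d + 1), ∑ a : Fin (d + 1), |A κ'' y * dz Ψ a w * hessFFAt (toSite r) Lc μ Y y w (Sum.inl κ'') (Sum.inl a)| :=
        Finset.sum_le_sum fun κ'' _ => Finset.abs_sum_le_sum_abs _ _
    _ ≤ ∑ _κ'' : Fin (d + 1), ∑ _a : Fin (d + 1), BA * BΨ * Cq * (Real.exp (-1 * l1 (y - (Lc : ℤ) • Y)) * Real.exp (-1 * l1 (w - (Lc : ℤ) • Y))) :=
        Finset.sum_le_sum fun κ'' _ => Finset.sum_le_sum fun a _ => hterm κ'' a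
    _ = _ := by simp only [Finset.sum_const, Finset.card_univ, Fintype.card_fin, nsmul_eq_mul, hCq]; ring

/-- NOT IN PRINT; OUR BOOKKEEPING.  **THE ITERATED TABLE IS UNIFORMLY BOUNDED IN THE CONSTRAINT SLOT** (in-block root, every `j`, bounded `n`, bounded `φ`): the table
`T_j(μ,Y) = Σ'_y Σ_κ″ (H_j n)(κ″,y)·(Σ'_w Σ_a hessFFAt ρ Lc μ Y y w (inl κ″)(inl a)·dz(φ∘blk) a w)` of (β) ∕ (δ2b) §3 ∕ (ε-Λ) §3 satisfies `|T_j(μ,Y)| ≤ BT` for all `(μ, Y)`. -/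
theorem abs_lambdaTable_le (hr : r ∈ box (d + 1) Lc) (j : ℕ) {n : Form1 (d + 1) ℝ} {Bn : ℝ} (hn : ∀ κ u, |n κ u| ≤ Bn)
    {φ : Site (d + 1) → ℝ} {Bφ : ℝ} (hφ : ∀ y, |φ y| ≤ Bφ) :
    ∃ BT : ℝ, 0 ≤ BT ∧ ∀ (μ : Fin (d + 1)) (Y : Site (d + 1)),
      |∑' y : Site (d + 1), ∑ κ'' : Fin (d + 1),
          (∑ κ, ∑' u : Site (d + 1), n κ u * colH (coDressKBmAt (toSite r) Lc (KInvStep (d := d) Lc j)) Lc κ u κ'' y)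
            * (∑' w : Site (d + 1), ∑ a : Fin (d + 1), hessFFAt (toSite r) Lc μ Y y w (Sum.inl κ'') (Sum.inl a) * dz (fun x => φ (blk Lc x)) a w)| ≤ BT := by
  classical
  set G : MKer (d + 1) (Fib d) := coDressKBmAt (toSite r) Lc (KInvStep (d := d) Lc j) with hGdef
  obtain ⟨BH, hBH0, hHb⟩ := abs_fieldResponse_le' (d := d) hr j hn
  have hBφ : 0 ≤ Bφ := (abs_nonneg _).trans (hφ 0)
  have hgb : ∀ a w, |dz (fun x => φ (blk Lc x)) a w| ≤ 2 * Bφ := KKTFluctuationEnergy.abs_dz_le (fun x => hφ (blk Lc x))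
  set M : ℝ := ((d + 1 : ℕ) : ℝ) * (((d + 1 : ℕ) : ℝ) * (BH * (2 * Bφ) * (2 * (ell (d + 1) Lc : ℝ) ^ 2 * Real.exp (4 * ((d : ℝ) + 1) * Lc * 1)))) with hM
  have hM0 : 0 ≤ M := by positivity
  refine ⟨M * (Zl (d + 1) 1 * Zl (d + 1) 1), by have := Zl_nonneg (D := d + 1) one_pos; positivity, fun μ Y => ?_⟩
  set Hn : Fin (d + 1) → Site (d + 1) → ℝ := fun κ'' y => ∑ κ, ∑' u : Site (d + 1), n κ u * colH G Lc κ u κ'' y with hHn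
  rw [← tsum_prod_hessFFAt_pairing_eq_iterated hr μ Y Hn (fun x => φ (blk Lc x))]
  set F : Site (d + 1) × Site (d + 1) → ℝ := fun yw => ∑ κ'' : Fin (d + 1), ∑ a : Fin (d + 1),
      Hn κ'' yw.1 * dz (fun x => φ (blk Lc x)) a yw.2 * hessFFAt (toSite r) Lc μ Y yw.1 yw.2 (Sum.inl κ'') (Sum.inl a) with hF
  set g : Site (d + 1) × Site (d + 1) → ℝ := fun yw => M * (Real.exp (-1 * l1 (yw.1 - (Lc : ℤ) • Y)) * Real.exp (-1 * l1 (yw.2 - (Lc : ℤ) • Y))) with hg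
  have hmaj : HasSum g (M * (Zl (d + 1) 1 * Zl (d + 1) 1)) := by
    have h1 := summable_exp_shift' (D := d + 1) one_pos ((Lc : ℤ) • Y)
    have h12 := h1.hasSum.mul h1.hasSum (h1.mul_of_nonneg h1 (fun _ => (Real.exp_pos _).le) (fun _ => (Real.exp_pos _).le))
    simp only [tsum_exp_shift'] at h12
    exact h12.mul_left M
  have hle : ∀ yw : Site (d + 1) × Site (d + 1), |F yw| ≤ g yw := fun yw =>
    abs_hessFFAt_pairing_summand_le hr μ Y (A := Hn) hHb hgb yw.1 yw.2
  have hsF : Summable F := Summable.of_norm_bounded hmaj.summable (fun yw => by rw [Real.norm_eq_abs]; exact hle yw)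
  calc |∑' yw : Site (d + 1) × Site (d + 1), F yw| ≤ ∑' yw : Site (d + 1) × Site (d + 1), |F yw| := by
        have h := norm_tsum_le_tsum_norm hsF.norm
        simpa only [Real.norm_eq_abs] using h
    _ ≤ ∑' yw : Site (d + 1) × Site (d + 1), g yw := hsF.abs.tsum_le_tsum hle hmaj.summable
    _ = _ := hmaj.tsum_eq

end Step

end Summit.QuantumFields.BalabanUV.Beta.GAN24.LambdaMemberPairing

end
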